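import Summits.BirchSwinnertonDyer.BirchSwinnertonDyer.Theses.PrintCf2
import Summits.BirchSwinnertonDyer.BirchSwinnertonDyer.Theorems.PrintCf2RamifiedOffTYZLargeConductor
import Summits.BirchSwinnertonDyer.Rank1Residual.P2.CongruentNumberLevelTwoDoor
import Summits.BirchSwinnertonDyer.BirchSwinnertonDyer.Theorems.PrintCf2RamifiedOffTYZJumpOneIsogeny
import HarnessLib

/-!
# SKELETON v8 of crux stmt-BirchSwinnertonDyer-20509 `RamifiedOffTYZOfFacts` (cell `bsd-print-cf2`, LEAD cruxlead-20509 g0, 2026-08-28)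

v8 (LEAD prover-cruxlead-stmt-BirchSwinnertonDyer-20509-g0-0, line `offtyz-v7`, cycle 1) = v7 (planner g12, sha16 54d7f62729747b28,
below) with ONE reshape — the ISOGENY SATURATION of the jump-one class folded into the glue (card «routine add-on for the lead»;
helper `Theorems/PrintCf2RamifiedOffTYZJumpOneIsogeny.lean`, p650357): the residual stub `stub_offTYZ_residualOffJumpOne` (off the
ℚ-MODELS `C • E_n = W` of jump-one `E_n`) is REPLACED by `stub_offTYZ_residualOffJumpOneIsogeny` (off the ℚ-ISOGENY CLASSES
`IsIsogenous W (E_n)` of jump-one `E_n`; one negated hypothesis changed, everything else verbatim) — a WEAKER stub (v7's implies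
it: `PrintCf2.offJumpOneIsogeny_of_offJumpOne`), so no proof aimed at v7 is invalidated; the member case of the glue is now
`PrintCf2.bsdp_two_of_bundle_of_levelTwoScriptLExact_of_jumpOneIsogeny` (C⁺ + conjuncts 1, 2, 3, 5 of 𝔅_ram: door on `E_n`,
Faltings `analyticRank_eq_of_isIsogenous'`, Cassels transport `Wuthrich2014.bsdp_of_isIsogenous`). Removed from the residual by
name: for every jump-one `E_n` of analytic rank one its `j = 1728` partner `y² = x³ + 4n²x` and its two `j = 287496` partners.
The six print-door stubs and C⁺ = `stub_offTYZ_levelTwoScriptLExact` are VERBATIM v7. Composition `RamifiedOffTYZOfFacts_of` =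
`PrintCf2.ramifiedOffTYZOfFacts_of_leaves_of_levelTwo_of_offJumpOneIsogeny` applied to the eight stubs (real proof, helper file).
Stubs open 8 / closed 0 / delegated 0 (door stubs 1–6: width 0 by ruling; residual: width 0 until a lever is named; C⁺: LEAD).
BSD is not proved by any of this; no class is closed by this file.

## v7 header (planner g12), kept for the record

Line `offtyz-v7` = line `offtyz-v6` (skeleton of record, sha a61d8c37 / 76bdbfc9, seat p1 g4 + planner g5; card `Lines/offtyz-v6.md`)
with its ONE research stub `stub_offTYZ_residual` (𝔅_ram ⟹ the large-conductor residual off every booked class, NO PRINT) CUT ALONG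
THE LEVEL-TWO DOOR landed by the cell typer (ty2 g11, `Summits/BirchSwinnertonDyer/Rank1Residual/P2/CongruentNumberLevelTwoDoor.lean`,
p600241/p600425): the planner-g5 idea card `heegner-redei-level-two` (HOME `bsd-print-cf2-plan/Ideas/idea-heegner-redei-level-two.md`,
evidence on 20509) becomes a REGISTERED stub.

The six print-door stubs of v6 are kept VERBATIM (same names and signatures, so every v6 stub proof still lands `--supports 20509`):
`stub_offTYZ_uPlusLeaf` · `stub_offTYZ_thetaLeaf` · `stub_offTYZ_shuZhaiLeaf` · `stub_offTYZ_thetaFourLeaf` · `stub_offTYZ_thetaCriterionLeaf`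
(each OPEN in-bundle with a CLOSED beyond-bundle twin aside: 20471 / 21185 / 21183+21395 / 21427 / 21428) · `stub_offTYZ_smallConductorLeaf`
(OPEN in-bundle; all-type twin aside 20770 CLOSED; Plus-closer `PrintCf2.ramifiedSmallConductor_of_bundlePlus`, Creutz–Miller / Miller–Stoll BY NAME).
v6's `stub_offTYZ_residual` is now a THEOREM of this file (`offTYZ_residualV6_of_stubs`, via the glue
`offTYZ_residualV6_of_levelTwo_of_offJumpOne`, real proof) from TWO new stubs:

* `stub_offTYZ_levelTwoScriptLExact` — **C⁺, the research statement of the card, in the door's exact binder shape** (hypothesis `hC` of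
  `P2.bsdp_two_congruentNumberCurve_of_levelTwoScriptLExact`, verbatim): for square-free `n ≡ 5, 6, 7 (mod 8)` with
  `ord_{s=1} L(E_n, s) = 1`, `#Sel₂(E_n) = 2⁵` (Heath-Brown excess `s(n) = 3`) and `#Sel₄(E_n) = 2⁶` (the Cassels–Tate pairing on the
  excess is non-degenerate: Ш(E_n)[4] = Ш(E_n)[2], the «jump-one» / G-locus of the census), EVERY integer `L` with `𝓛(n)² = L²`
  (`TianYuanZhang2017.IsScriptL n L`) satisfies `2 ∣ L ∧ 4 ∤ L`. OPEN, NO PRINT (Tian–Yuan–Zhang's genus-period induction read one 2-adic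
  digit up; nothing in print on the rank-one side at level 2). On that class the door is EXACT
  (`P2.bsdp_two_congruentNumberCurve_iff_two_dvd_not_four_dvd`: granted GZK, `BSD(E_n,2) ⟺ 2 ∥ L`), so C⁺ is EQUIVALENT to BSD₂ on the
  jump-one class — not a strengthening. Census (instrument, not evidence of proof): G-locus = 2196 / 2417 = 90.9 % of category D
  (k ≤ 2 odd primes, n ≤ 10⁵; kit j299242), and Ш_an = 4.000… (38 digits, v₂ = 2) on 388 / 388 computed G members n ≤ 2·10⁴ (j300539) —
  i.e. C⁺ holds numerically on every computed case, 0 anomalies (HOME `bsd-print-cf2-plan/Ideas/census-1e5/ANALYSIS.md` + Addendum 2).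
* `stub_offTYZ_residualOffJumpOne` — v6's residual with ONE MORE exclusion: `W` is not a `ℚ`-MODEL (`C • E_n = W`) of a jump-one `E_n`
  (`n` square-free, `n ≡ 5, 6, 7 (mod 8)`, `#Sel₂(E_n) = 2⁵`, `#Sel₄(E_n) = 2⁶`). OPEN, NO PRINT. Contains: the `E_m` classes of conductor
  `≥ 5000` with `s(m) = 3` and Ш(E_m)[4] ≠ Ш(E_m)[2] (the census B-locus with `r_an = 1`: Ш_an = 16 on 14 / 14 computed, i.e. level ≥ 3),
  with `s(m) ≥ 5`, or `s(m) = 1` with even genus sums Θ-silent / θ-uncontrolled; the `j = 1728` ISOGENY PARTNERS of jump-one `E_n` that are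
  not themselves models of one (isogeny saturation of the jump-one class by Cassels' invariance `Wuthrich2014.bsdp_of_isIsogenous` — conjunct 3
  of 𝔅_ram — is a routine add-on the lead may fold into the glue); quartic-twist classes without any `E_m`; all of `j = 8000`; each off the
  Shu–Zhai / four-prime-theta / Θ-criterion classes and in conductor `≥ 5000` as in v6.

Glue (real proofs, no sorry): `offTYZ_residualV6_of_levelTwo_of_offJumpOne` (case split on jump-one model membership; the member case is
the door `P2.bsdp_two_of_levelTwoScriptLExact_of_smul_of_analyticRank_eq_one` fed with conjunct 5 `thm12_parity_of_scriptL'` and conjunct 1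
GZK of 𝔅_ram) and the composition `RamifiedOffTYZOfFacts_of` through v6's helper
`PrintCf2.offTYZProved_of_bundle_of_uPlus_of_theta_of_shuZhai_of_thetaFour_of_thetaCriterion_of_smallConductor_of_offLarge` (p569950).
Hardest stub: `stub_offTYZ_residualOffJumpOne` (XL, no lever in hand); first research target: `stub_offTYZ_levelTwoScriptLExact` (L).
Disproof used: none filed on 20509 (`ledger crux ls` empty). Dead lines honoured: the naive level-2 GENUS LAW for the CT step (card K1 as first
written) is FALSE beyond n = 8000 (census-30000 twin test: 2 mixed classes) — C⁺ does NOT use it: its hypothesis is the 4-Selmer count itself,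
not a class-group predictor of it. BSD is not proved by any of this; no class is closed by this file.
-/

noncomputable section

open Summit.BirchSwinnertonDyer Summit.BirchSwinnertonDyer.BirchSwinnertonDyer.Theses.PrintCf2
open Literature.NumberTheory.EllipticCurves Literature.NumberTheory.EllipticCurves.TianYuanZhang2017

namespace Summit.BirchSwinnertonDyer.PrintCf2

/-- STUB (open in-bundle; twin aside 20471 closed): 𝔅_ram ⟹ the U⁺-road leaf. -/
theorem stub_offTYZ_uPlusLeaf : (Literature.NumberTheory.EllipticCurves.rank_eq_analyticRank_of_analyticRank_le_one ∧ WeierstrassCurve.hasEntireLFunction_rat ∧ WeierstrassCurve.bsdRHS_eq_of_isIsogenous ∧ Literature.NumberTheory.EllipticCurves.bsdTriple_of_hasCM_of_L_one_ne_zero ∧ Literature.NumberTheory.EllipticCurves.TianYuanZhang2017.thm12_parity_of_scriptL' ∧ Literature.NumberTheory.EllipticCurves.Tian2014.thm13_rank_one_and_sha_odd ∧ Literature.NumberTheory.QuadraticFields.RedeiReichardt.redeiReichardt_fourTwoCard_classGroup ∧ Literature.NumberTheory.EllipticCurves.LiLiuTian2024.thm12_bsd_congruentNumberCurve ∧ Literature.NumberTheory.EllipticCurves.Monsky1990.cor515_rank_eq_one_and_card_selmerGroup_two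 ∧ Literature.NumberTheory.EllipticCurves.HeathBrown1994.monsky_card_selmerGroup_two_even ∧ Literature.NumberTheory.EllipticCurves.Tian2014.tian2014_system_sMinus_genus) → Summit.BirchSwinnertonDyer.WAllCornerFTwoRamifiedTYZUPlus := by
  sorry

/-- STUB (open in-bundle; twin aside 21185 closed): 𝔅_ram ⟹ the theta leaf. -/
theorem stub_offTYZ_thetaLeaf : (Literature.NumberTheory.EllipticCurves.rank_eq_analyticRank_of_analyticRank_le_one ∧ WeierstrassCurve.hasEntireLFunction_rat ∧ WeierstrassCurve.bsdRHS_eq_of_isIsogenous ∧ Literature.NumberTheory.EllipticCurves.bsdTriple_of_hasCM_of_L_one_ne_zero ∧ Literature.NumberTheory.EllipticCurves.TianYuanZhang2017.thm12_parity_of_scriptL' ∧ Literature.NumberTheory.EllipticCurves.Tian2014.thm13_rank_one_and_sha_odd ∧ Literature.NumberTheory.QuadraticFields.RedeiReichardt.redeiReichardt_fourTwoCard_classGroup ∧ Literature.NumberTheory.EllipticCurves.LiLiuTian2024.thm12_bsd_congruentNumberCurve ∧ Literature.NumberTheory.EllipticCurves.Monsky1990.cor515_rank_eq_one_and_card_selmerGroup_two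 ∧ Literature.NumberTheory.EllipticCurves.HeathBrown1994.monsky_card_selmerGroup_two_even ∧ Literature.NumberTheory.EllipticCurves.Tian2014.tian2014_system_sMinus_genus) → Summit.BirchSwinnertonDyer.WAllCornerFTwoRamifiedTheta := by
  sorry

/-- STUB (open in-bundle; twin asides 21183/21395 closed, seat p2): 𝔅_ram ⟹ the Shu–Zhai `256c1` leaf. -/
theorem stub_offTYZ_shuZhaiLeaf : (Literature.NumberTheory.EllipticCurves.rank_eq_analyticRank_of_analyticRank_le_one ∧ WeierstrassCurve.hasEntireLFunction_rat ∧ WeierstrassCurve.bsdRHS_eq_of_isIsogenous ∧ Literature.NumberTheory.EllipticCurves.bsdTriple_of_hasCM_of_L_one_ne_zero ∧ Literature.NumberTheory.EllipticCurves.TianYuanZhang2017.thm12_parity_of_scriptL' ∧ Literature.NumberTheory.EllipticCurves.Tian2014.thm13_rank_one_and_sha_odd ∧ Literature.NumberTheory.QuadraticFields.RedeiReichardt.redeiReichardt_fourTwoCard_classGroup ∧ Literature.NumberTheory.EllipticCurves.LiLiuTian2024.thm12_bsd_congruentNumberCurve ∧ Literature.NumberTheory.EllipticCurves.Monsky1990.cor515_rank_eq_one_and_card_selmerGroup_two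 ∧ Literature.NumberTheory.EllipticCurves.HeathBrown1994.monsky_card_selmerGroup_two_even ∧ Literature.NumberTheory.EllipticCurves.Tian2014.tian2014_system_sMinus_genus) → Summit.BirchSwinnertonDyer.WAllCornerFTwoRamifiedShuZhaiTwoFiftySix := by
  sorry

/-- STUB (open in-bundle; twin aside 21427 closed): 𝔅_ram ⟹ the four-prime theta leaf. -/
theorem stub_offTYZ_thetaFourLeaf : (Literature.NumberTheory.EllipticCurves.rank_eq_analyticRank_of_analyticRank_le_one ∧ WeierstrassCurve.hasEntireLFunction_rat ∧ WeierstrassCurve.bsdRHS_eq_of_isIsogenous ∧ Literature.NumberTheory.EllipticCurves.bsdTriple_of_hasCM_of_L_one_ne_zero ∧ Literature.NumberTheory.EllipticCurves.TianYuanZhang2017.thm12_parity_of_scriptL' ∧ Literature.NumberTheory.EllipticCurves.Tian2014.thm13_rank_one_and_sha_odd ∧ Literature.NumberTheory.QuadraticFields.RedeiReichardt.redeiReichardt_fourTwoCard_classGroup ∧ Literature.NumberTheory.EllipticCurves.LiLiuTian2024.thm12_bsd_congruentNumberCurve ∧ Literature.NumberTheory.EllipticCurves.Monsky1990.cor515_rank_eq_one_and_card_selmerGroup_two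 ∧ Literature.NumberTheory.EllipticCurves.HeathBrown1994.monsky_card_selmerGroup_two_even ∧ Literature.NumberTheory.EllipticCurves.Tian2014.tian2014_system_sMinus_genus) → Summit.BirchSwinnertonDyer.WAllCornerFTwoRamifiedThetaFour := by
  sorry

/-- STUB (open in-bundle; twin aside 21428 closed): 𝔅_ram ⟹ the uniform Θ-criterion leaf. -/
theorem stub_offTYZ_thetaCriterionLeaf : (Literature.NumberTheory.EllipticCurves.rank_eq_analyticRank_of_analyticRank_le_one ∧ WeierstrassCurve.hasEntireLFunction_rat ∧ WeierstrassCurve.bsdRHS_eq_of_isIsogenous ∧ Literature.NumberTheory.EllipticCurves.bsdTriple_of_hasCM_of_L_one_ne_zero ∧ Literature.NumberTheory.EllipticCurves.TianYuanZhang2017.thm12_parity_of_scriptL' ∧ Literature.NumberTheory.EllipticCurves.Tian2014.thm13_rank_one_and_sha_odd ∧ Literature.NumberTheory.QuadraticFields.RedeiReichardt.redeiReichardt_fourTwoCard_classGroup ∧ Literature.NumberTheory.EllipticCurves.LiLiuTian2024.thm12_bsd_congruentNumberCurve ∧ Literature.NumberTheory.EllipticCurves.Monsky1990.cor515_rank_eq_one_and_card_selmerGroup_two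 ∧ Literature.NumberTheory.EllipticCurves.HeathBrown1994.monsky_card_selmerGroup_two_even ∧ Literature.NumberTheory.EllipticCurves.Tian2014.tian2014_system_sMinus_genus) → Summit.BirchSwinnertonDyer.WAllCornerFTwoRamifiedThetaCriterion := by
  sorry

/-- STUB (open in-bundle; closable beyond it by `PrintCf2.ramifiedSmallConductor_of_bundlePlus`; all-type twin aside 20770
closed): 𝔅_ram ⟹ the ramified small-conductor leaf (conductor `< 5000`, Creutz–Miller / Miller–Stoll territory). -/
theorem stub_offTYZ_smallConductorLeaf : (Literature.NumberTheory.EllipticCurves.rank_eq_analyticRank_of_analyticRank_le_one ∧ WeierstrassCurve.hasEntireLFunction_rat ∧ WeierstrassCurve.bsdRHS_eq_of_isIsogenous ∧ Literature.NumberTheory.EllipticCurves.bsdTriple_of_hasCM_of_L_one_ne_zero ∧ Literature.NumberTheory.EllipticCurves.TianYuanZhang2017.thm12_parity_of_scriptL' ∧ Literature.NumberTheory.EllipticCurves.Tian2014.thm13_rank_one_and_sha_odd ∧ Literature.NumberTheory.QuadraticFields.RedeiReichardt.redeiReichardt_fourTwoCard_classGroup ∧ Literature.NumberTheory.EllipticCurves.LiLiuTian2024.thm12_bsd_congruentNumberCurve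 ∧ Literature.NumberTheory.EllipticCurves.Monsky1990.cor515_rank_eq_one_and_card_selmerGroup_two ∧ Literature.NumberTheory.EllipticCurves.HeathBrown1994.monsky_card_selmerGroup_two_even ∧ Literature.NumberTheory.EllipticCurves.Tian2014.tian2014_system_sMinus_genus) →
    (∀ (W : WeierstrassCurve ℚ) [W.IsElliptic] [W.IsGloballyMinimal],
      W.HasCM → W.analyticRank = 1 → Literature.NumberTheory.EllipticCurves.Rank1Residual.CMRamified W 2 →
        W.conductorNorm ℤ < 5000 → Literature.NumberTheory.EllipticCurves.BSDp W 2) := by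
  sorry

/-- STUB **C⁺ = `LevelTwoScriptLExact`** (OPEN, NO PRINT; research statement of the card `heegner-redei-level-two`, in the exact binder shape
of the door's hypothesis `hC`): on the jump-one class of the congruent-number residual (`n` square-free, `n ≡ 5, 6, 7 (mod 8)`,
`ord_{s=1} L(E_n,s) = 1`, `#Sel₂(E_n) = 2⁵`, `#Sel₄(E_n) = 2⁶`) the Tian–Yuan–Zhang integer `𝓛(n)` is EXACTLY divisible by `2`.
Equivalent to `BSD(E_n, 2)` on that class granted GZK (`P2.bsdp_two_congruentNumberCurve_iff_two_dvd_not_four_dvd`). Size L–XL. -/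
theorem stub_offTYZ_levelTwoScriptLExact :
    ∀ (n : ℕ) [(congruentNumberCurve n).IsElliptic] [(congruentNumberCurve n).IsGloballyMinimal],
      Squarefree n → (n % 8 = 5 ∨ n % 8 = 6 ∨ n % 8 = 7) →
      (congruentNumberCurve n).analyticRank = 1 →
      Nat.card ((congruentNumberCurve n).selmerGroup 2) = 2 ^ 5 →
      Nat.card ((congruentNumberCurve n).selmerGroup 4) = 2 ^ 6 →
      ∀ L : ℤ, IsScriptL n L → (2 : ℤ) ∣ L ∧ ¬ (4 : ℤ) ∣ L := by
  sorry

/-- STUB (OPEN, NO PRINT; v8 reshape of v7's `stub_offTYZ_residualOffJumpOne` — ISOGENY-SATURATED): 𝔅_ram ⟹ v6's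
large-conductor residual OFF THE `ℚ`-ISOGENY CLASSES OF THE JUMP-ONE `E_n` — CM, `r_an = 1`, `2 ∣ d_K`, isogenous to no booked `E_n`,
to no Shu–Zhai twist of `256c1`, to no four-prime theta member, to no Θ-criterion member, conductor `≥ 5000`, and NOT `ℚ`-ISOGENOUS
to a jump-one `E_n` (`n` square-free, `n ≡ 5, 6, 7 (mod 8)`, `#Sel₂(E_n) = 2⁵`, `#Sel₄(E_n) = 2⁶`) ⇒ `BSD(E,2)`. Weaker than v7's
stub (`PrintCf2.offJumpOneIsogeny_of_offJumpOne`). Contains: the `E_m` classes with `s(m) = 3` and Ш[4] ≠ Ш[2] (census B-locus with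
`r_an = 1`: Ш_an = 16), `s(m) ≥ 5`, `s(m) = 1` with even genus sums Θ-silent / θ-uncontrolled; the quartic-twist classes
`y² = x³ + Dx` containing no `E_m`; all of `j = 8000`. Size XL. -/
theorem stub_offTYZ_residualOffJumpOneIsogeny : (Literature.NumberTheory.EllipticCurves.rank_eq_analyticRank_of_analyticRank_le_one ∧ WeierstrassCurve.hasEntireLFunction_rat ∧ WeierstrassCurve.bsdRHS_eq_of_isIsogenous ∧ Literature.NumberTheory.EllipticCurves.bsdTriple_of_hasCM_of_L_one_ne_zero ∧ Literature.NumberTheory.EllipticCurves.TianYuanZhang2017.thm12_parity_of_scriptL' ∧ Literature.NumberTheory.EllipticCurves.Tian2014.thm13_rank_one_and_sha_odd ∧ Literature.NumberTheory.QuadraticFields.RedeiReichardt.redeiReichardt_fourTwoCard_classGroup ∧ Literature.NumberTheory.EllipticCurves.LiLiuTian2024.thm12_bsd_congruentNumberCurve ∧ Literature.NumberTheory.EllipticCurves.Monsky1990.cor515_rank_eq_one_and_card_selmerGroup_two ∧ Literature.NumberTheory.EllipticCurves.HeathBrown1994.monsky_card_selmerGroup_two_even ∧ Literature.NumberTheory.EllipticCurves.Tian2014.tian2014_system_sMinus_genus)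 →
    (∀ (W : WeierstrassCurve ℚ) [W.IsElliptic] [W.IsGloballyMinimal],
      W.HasCM → W.analyticRank = 1 → Literature.NumberTheory.EllipticCurves.Rank1Residual.CMRamified W 2 →
        ¬ Summit.BirchSwinnertonDyer.CongruentBookedIsogenyClass W →
        ¬ Summit.BirchSwinnertonDyer.Rank1Residual.P2.IsIsogenousToShuZhaiTwoFiftySixTwist W →
        ¬ Summit.BirchSwinnertonDyer.CongruentThetaFourIsogenyClass W →
        ¬ Summit.BirchSwinnertonDyer.CongruentThetaCriterionIsogenyClass W →
        5000 ≤ W.conductorNorm ℤ →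
        ¬ (∃ n : ℕ, Squarefree n ∧ (n % 8 = 5 ∨ n % 8 = 6 ∨ n % 8 = 7) ∧
            Nat.card ((congruentNumberCurve n).selmerGroup 2) = 2 ^ 5 ∧
            Nat.card ((congruentNumberCurve n).selmerGroup 4) = 2 ^ 6 ∧ WeierstrassCurve.IsIsogenous W (congruentNumberCurve n)) →
        Literature.NumberTheory.EllipticCurves.BSDp W 2) := by
  sorry

/-- v6's residual stub `stub_offTYZ_residual`, DERIVED from C⁺ and the isogeny-saturated residual by the landed glue
`PrintCf2.offTYZ_residualV6_of_levelTwo_of_offJumpOneIsogeny` (helper file, real proof: excluded middle on the jump-one isogeny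
witness; witness case = door on `E_n` + Faltings + Cassels transport). -/
theorem offTYZ_residualV6_of_stubs : (Literature.NumberTheory.EllipticCurves.rank_eq_analyticRank_of_analyticRank_le_one ∧ WeierstrassCurve.hasEntireLFunction_rat ∧ WeierstrassCurve.bsdRHS_eq_of_isIsogenous ∧ Literature.NumberTheory.EllipticCurves.bsdTriple_of_hasCM_of_L_one_ne_zero ∧ Literature.NumberTheory.EllipticCurves.TianYuanZhang2017.thm12_parity_of_scriptL' ∧ Literature.NumberTheory.EllipticCurves.Tian2014.thm13_rank_one_and_sha_odd ∧ Literature.NumberTheory.QuadraticFields.RedeiReichardt.redeiReichardt_fourTwoCard_classGroup ∧ Literature.NumberTheory.EllipticCurves.LiLiuTian2024.thm12_bsd_congruentNumberCurve ∧ Literature.NumberTheory.EllipticCurves.Monsky1990.cor515_rank_eq_one_and_card_selmerGroup_two ∧ Literature.NumberTheory.EllipticCurves.HeathBrown1994.monsky_card_selmerGroup_two_even ∧ Literature.NumberTheory.EllipticCurves.Tian2014.tian2014_system_sMinus_genus) →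
    (∀ (W : WeierstrassCurve ℚ) [W.IsElliptic] [W.IsGloballyMinimal],
      W.HasCM → W.analyticRank = 1 → Literature.NumberTheory.EllipticCurves.Rank1Residual.CMRamified W 2 →
        ¬ Summit.BirchSwinnertonDyer.CongruentBookedIsogenyClass W →
        ¬ Summit.BirchSwinnertonDyer.Rank1Residual.P2.IsIsogenousToShuZhaiTwoFiftySixTwist W →
        ¬ Summit.BirchSwinnertonDyer.CongruentThetaFourIsogenyClass W →
        ¬ Summit.BirchSwinnertonDyer.CongruentThetaCriterionIsogenyClass W →
        5000 ≤ W.conductorNorm ℤ → Literature.NumberTheory.EllipticCurves.BSDp W 2) :=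
  offTYZ_residualV6_of_levelTwo_of_offJumpOneIsogeny stub_offTYZ_levelTwoScriptLExact stub_offTYZ_residualOffJumpOneIsogeny

/-- COMPOSITION: the crux decl BY NAME from the eight stubs (helper `PrintCf2.ramifiedOffTYZOfFacts_of_leaves_of_levelTwo_of_offJumpOneIsogeny`
= v6's composition through p569950 with the v8 glue in the residual slot). -/
theorem RamifiedOffTYZOfFacts_of : RamifiedOffTYZOfFacts :=
  ramifiedOffTYZOfFacts_of_leaves_of_levelTwo_of_offJumpOneIsogeny stub_offTYZ_uPlusLeaf stub_offTYZ_thetaLeaf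
    stub_offTYZ_shuZhaiLeaf stub_offTYZ_thetaFourLeaf stub_offTYZ_thetaCriterionLeaf stub_offTYZ_smallConductorLeaf
    stub_offTYZ_levelTwoScriptLExact stub_offTYZ_residualOffJumpOneIsogeny

end Summit.BirchSwinnertonDyer.PrintCf2

end
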